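import Literature.NumberTheory.Automorphic.ShimuraCurveRibetTakahashi
import HarnessLib

/-!
# ABC harvest 2015–2026: the Shimura-degree door `δ_{D,M}(E) ≤ C · N_E^K` (Pasten 2024, Thm 1.7), typed

`Summits/ABC/Harvest/ShimuraDegree.lean` — cell `abc-harv` (C3, recent-literature harvest), seat `abc-harv-typ-1`
(KEY G09-SHIMURA), namespace `Summit.ABC.Harvest`. STATEMENT-ONLY file (D-0064; companion of
`Summits/ABC/Harvest/OpenQuestions.lean`, row H-020 / census C3 = desk O-66, whose table records «general `δ_{D,M}`:
no carrier yet»): ONE proof-free `@[conjecture] def ShimuraDegreeConjecture : Prop` — "`δ_{D,M}(E)` is bounded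
polynomially on the conductor for ONE admissible factorisation `N_E = D·M` per curve" — over the tree's Shimura-curve
vocabulary `Literature.NumberTheory.Automorphic.{IsAdmissibleFactorization, ShimuraCurveData, ShimuraParametrizationData,
ShimuraParametrizationData.IsMinimalFor}` (`Literature/NumberTheory/Automorphic/ShimuraCurve.lean`,
`ShimuraCurveRibetTakahashi.lean`), i.e. EXACTLY the rendering of `δ_{D,M}(E)` used by the tree's named fact
`Literature.NumberTheory.Automorphic.PastenShimura2024_thm_6_1` (Pasten's refined Ribet–Takahashi formula): `δ_{D,M}(E)
= P.deg` for a Shimura-curve parametrisation datum `P` on `X₀^D(M)` with `P.IsMinimalFor E` (least degree among the data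
on `X` of all curves `ℚ`-isogenous to `E`). It lives in its own file, not in `OpenQuestions.lean`, only because the carrier
import `Literature.NumberTheory.Automorphic.ShimuraCurveRibetTakahashi` would otherwise enter the import closure of every
Harvest glue file.

The SORRY-FREE glue is `Summits/ABC/Harvest/GlueShimura.lean` (§GLUE LEDGER G-09):
`Summit.ABC.Harvest.polySzpiroRat_of_shimuraDegreeConjecture (h61 : PastenShimura2024_thm_6_1)
(hmod : nonempty_modularParametrizationData) (h163 : PastenShimura2024_minimalDegree_le_163_mul) :
ShimuraDegreeConjecture → Summit.ABC.PolySzpiroRat`, with an EFFECTIVE form on `Summit.ABC.PolySzpiroRatEff` — Pasten's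
"such a bound would imply Szpiro's conjecture!" (§1.4) in kernel form at rung A-PS, modulo three NAMED printed theorems
(refined Ribet–Takahashi = Thm 6.1; modularity with an integral Manin constant; Mazur–Kenku) and NO «polynomial Tamagawa
bound» hypothesis: the factor `∏_{p∣D} v_p(Δ_E)` of display (6.1) is absorbed by the bootstrap of Pasten's own proof of
Thm 7.6 (p. 27), made explicit.

Source, read at the page [corpus: paper:arxiv-1705.09251 = H. Pasten, *Shimura curves and the abc conjecture*, J. Number
Theory 254 (2024) 214–335]: §1.3 p. 6 (chunk p0006 L7–L37: the classical modular approach, `h(E) ≤ ½ log deg φ + 9`,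
"Hence, Szpiro's conjecture would follow if one can show that the modular degree `δ_{1,N} = deg φ` is bounded polynomially
on the conductor `N`", the quantities `δ_{D,M}(E)`, Theorem 1.7); §1.4 p. 9 (chunk p0009 L3, quoted below); §2 p. 12
(admissible factorisations, `q_{D,M} q_{D,M}^∨ = [δ_{D,M}]`); §7.5 Thm 7.6 and its proof p. 27 (chunk p0027 L40–L61).

HONESTY LINE (HUMAN D-0138/D-0139/D-0140; in every summary): abc is not proved by any of this; A-PS is NOT abc — «NOT abc —
POLY-SZPIRO(E)»; typed ≠ proved; PROVED-MOD-FACTS ≠ proved; a primary is a source, not an endorsement; quoting ≠ agreeing;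
no side taken on [IUTchIII] Cor 3.12. The `def` below is an OPEN statement used only as a hypothesis or a conclusion;
nothing is asserted. No `sorry`, no axiom, no `instance`, no notation, no Literature fact.

## Row ↔ declaration (HARVEST.md ids; glue names live in `GlueShimura.lean`)

| row | source [locator] | decl | glue / positioning |
|---|---|---|---|
| H-020 (general `(D, M)`; census C3 = O-66; §GLUE LEDGER G-09) | Pasten JNT 254 (2024) §1.3 Thm 1.7 = §7.5 Thm 7.6, §1.4 p. 9 | `ShimuraDegreeConjecture` | ⟹ `Summit.ABC.PolySzpiroRat` PROVED-MOD-FACTS [Thm 6.1, modularity, Mazur–Kenku] (`polySzpiroRat_of_shimuraDegreeConjecture`, effective `polySzpiroRatEff_of_log_shimuraDegree_le`); the `(D, M) = (1, N)` instance is `ModularDegreeConjecture`'s datum (`OpenQuestions.lean` §2) |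

## Design

* `E/ℚ` = `W : WeierstrassCurve ℚ` with `[W.IsElliptic]`, `N_E = W.conductorNorm ℤ` (model-independent), as in
  `OpenQuestions.lean`; "`δ ≤ C·N^K`" is typed as `log δ ≤ K · log N_E + C` (the cell's idiom; `N_E ≥ 11`).
* ONE admissible `(D, M)` per curve (`∃`), the datum quantified existentially together with its Shimura curve datum `X` —
  the reading of the cell's ENGINE C3 (ii) «a polynomial bound `δ_{D,M}(E) ≤ C·N^K` for ONE admissible `(D,M)` per `E`»
  and of §GLUE LEDGER G-09; it is the weakest form that gives A-PS and it needs no Jacquet–Langlands existence fact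
  (`nonempty_shimuraParametrizationData`) to be instantiated. Pasten's literal "each `δ_{D,M}`" (every admissible pair) is
  the stronger `∀`-form; both contain the `D = 1` door `ModularDegreeConjecture` (Conj. 3.2) as the pair `(1, N)`.
* NOT here: `δ_{1,N}` (typed: `ModularDegreeConjecture`), the ratio theorems `δ_{1,N}/δ_{D,M}` (typed and partly proved:
  `PastenShimura2024_thm_6_1`, `_thm_6_1_b`, `ShimuraCurveRibetTakahashi*Proofs`), Conj. 1.14 (`SmallTamagawaConjecture`).
-/

noncomputable section

namespace Summit.ABC.Harvest

open Literature.NumberTheory.Automorphic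

/-- **The Shimura-degree door** (Pasten 2024, Thm 1.7 = Thm 7.6 "The Shimura curve approach to `abc`", and §1.4):
there are `K, C` such that EVERY elliptic curve `E/ℚ` (any model `W`, conductor `N_E = W.conductorNorm ℤ`) admits SOME
admissible factorisation `N_E = D · M` (`IsAdmissibleFactorization`: `D` squarefree with an even number of prime factors,
`gcd(D, M) = 1`, possibly `D = 1`), a Shimura curve datum `X` of level `(D, M)` (an analytic presentation of `X₀^D(M)`)
and a parametrisation datum `P : ShimuraParametrizationData X W'` REALISING `δ_{D,M}(E)` — `P.IsMinimalFor W`: `W'` is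
`ℚ`-isogenous to `W` and `P` has the least degree among all data on `X` of all curves `ℚ`-isogenous to `W`, the tree's
rendering of Pasten's `δ_{D,M}(E)` (§2 p. 12: "`q_{D,M} : J₀^D(M) → A_{D,M}` … with `A_{D,M}` isogenous to `E`",
`q_{D,M} q_{D,M}^∨ = [δ_{D,M}]`; the idiom of `Literature.NumberTheory.Automorphic.PastenShimura2024_thm_6_1`) — with
`log P.deg ≤ K · log N_E + C`, i.e. `δ_{D,M}(E) ≤ e^C · N_E^K`.

Printed source. §1.3 [arXiv:1705.09251 p. 6]: "given an elliptic curve `E` over `ℚ` and an admissible factorization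
`N = DM` of its conductor, we have the optimal quotients `q_{D,M} : J₀^D(M) → A_{D,M}` with `A_{D,M}` isogenous to `E`
over `ℚ`, and the associated quantities `δ_{D,M} = δ_{D,M}(E)`. A natural question is whether bounds for the numbers
`δ_{D,M}(E)` are useful in the study of Szpiro's conjecture, beyond the classical case `D = 1`. We show that this is
indeed the case […] **Theorem 1.7** (cf. Theorem 7.6). Let `ε > 0`. For all elliptic curves `E` of conductor `N ≫_ε 1`
(with an effective implicit constant), and for any admissible factorization `N = DM` we have
`log|Δ_E| < (6 + ε) log δ_{D,M}(E)` and `h(E) < (1/2 + ε) log δ_{D,M}(E)`." §1.4 [p. 9]: "Although at present it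
seems that bounding each `δ_{D,M}` polynomially on the conductor `N` is out of reach (in fact, such a bound would imply
Szpiro's conjecture! cf. Theorem 1.7), it turns out that the comparison ratios `δ_{1,N}/δ_{D,M}` are more accessible and
we can unconditionally bound them polynomially on `N`." OPEN (author: "out of reach at present"; record in the `δ`
currency: `log δ_{1,N} ≤ (1/5) N log N`, Murty–Pasten 2013 = tree `MurtyPasten.log_modularDegree_le`, transported to
`δ_{D,M}` by Thm 6.1 (b)).

STRENGTH-IF-REALISED: ≥ A-PS DOOR — «NOT abc — POLY-SZPIRO(E = 7K + 101)»: ⟹ `Summit.ABC.PolySzpiroRatEff (7K + 101)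
(7C + 145)` for ALL `E/ℚ`, PROVED MODULO THREE NAMED FACTS in `Summits/ABC/Harvest/GlueShimura.lean`
(`polySzpiroRatEff_of_log_shimuraDegree_le`, `polySzpiroRat_of_shimuraDegreeConjecture`): `h61` = Pasten's refined
Ribet–Takahashi formula `PastenShimura2024_thm_6_1` (Thm 6.1, numerator of `γ_{D,M,E}` at most `163^{ω(D)}`), `hmod` =
modularity with an integral Manin constant (`nonempty_modularParametrizationData`), `h163` = Mazur–Kenku
(`PastenShimura2024_minimalDegree_le_163_mul`); the factor `∏_{p∣D} v_p(Δ_E)` of (6.1) costs NO hypothesis (bootstrap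
of the proof of Thm 7.6, p. 27, explicit). Asymptotically the exponent is `(6 + ε)K` (Thm 7.6). Not A0: at `K = 2 + ε` on
Frey curves and `D = 1` this is the abc-strength door `Summit.ABC.ABC.Theses.DefiniteXi.FreyDegreeBound` (row H-001).
The converse A-PS ⟹ this door is NOT known (it would need A-PS ⟹ Height, open: the archimedean `log⁺|j|` term;
cell ENGINE C3 (iii)) ⇒ a PATH at rung A-PS, not a restatement. Relation to the `D = 1` door: the pair `(1, N_E)` is
admissible and `δ_{1,N}` is `ModularDegreeConjecture`'s class-minimal degree, so Conj. 3.2 gives this statement with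
`(D, M) = (1, N)` (modulo the split-case transport `X₀(N) → X₀^1(N)` of the tree,
`ShimuraParametrizationSplitDegreeProofs`); Pasten's motivation (§1.3 p. 6): "For an admissible factorization `N = DM`,
the curve `X₀^D(M)` usually has genus smaller than that of `X₀(N)`, which can be expected to lead to bounds for `δ_{D,M}`
of better quality than for `δ_{1,N}`." PATH-TO-ABC: Shimura-curve degrees / Jacquet–Langlands side (named; Thm 1.7
PROVED in print; ratio `δ_{1,N}/δ_{D,M}` PROVED polynomial in print, Thm 6.1). EFFECTIVE: yes (all constants explicit in
the glue). Cheapest falsifier: for semistable `E` and `D = pq`, Thm 6.1 (b) pins `δ_{pq,M}` to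
`δ_{1,N}/(v_p(Δ_E) v_q(Δ_E))` up to a factor supported on primes `≤ 163` with bounded exponents, so Cremona's `deg φ`
table (`alldegphi`) already computes `log δ_{pq,M}/log N` up to `O(1/log N)` — a kit job of minutes; no direct table of
`δ_{D,M}` for `D > 1` is held (no engine for degrees of `X₀^D(M) → E`; Voight–Willis-type computations not staged).
CALIBRATION (R2; legend in `OpenQuestions.lean`): the `(D, M) = (1, N)` instance inherits `ModularDegreeConjecture`'s
floors verbatim (j285537 = j285151 over `[ecdata]`: `C = 0 ⇒ K ≥ 2.1776`, `C = 5 ⇒ K ≥ 1.7788`, both at 279366b1; THEOREM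
floor `K < 3/2` false at `D = 1`, `Summit.ABC.Analytic.not_polyModularDegreeRat_of_lt_three_halves`); for the `∃ (D, M)`
statement itself no finite-range floor follows from held data, because (EqUpperRT) `log δ_{1,N} ≤ log δ_{D,M} +
log ∏_{p∣D} v_p(Δ_E) + 5.1·ω(D)` only bounds `δ_{D,M}` from BELOW by `δ_{1,N}/(163^{ω(D)} ∏ v_p)`, which is `< 1` at the
record curve 279366b1 for `D = N` (`ω = 4`, `∏ v_p = 40·28·10·1`). computed ≠ proved; a calibration bounds constants from
BELOW only and is no evidence for the statement. NOT abc — POLY-SZPIRO(E).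
[cite: PastenShimura2024, Thm. 1.7 (§1.3 p. 6) = Thm. 7.6 (§7.5 p. 27), and §1.4 p. 9] [status: open] -/
@[conjecture] def ShimuraDegreeConjecture : Prop :=
  ∃ K C : ℝ, ∀ (W : WeierstrassCurve ℚ) [W.IsElliptic],
    ∃ (D M : ℕ) (X : ShimuraCurveData D M) (W' : WeierstrassCurve ℚ) (_ : W'.IsElliptic)
      (P : ShimuraParametrizationData X W'),
      IsAdmissibleFactorization (W.conductorNorm ℤ) D M ∧ P.IsMinimalFor W ∧
        Real.log (P.deg : ℝ) ≤ K * Real.log (W.conductorNorm ℤ : ℝ) + C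

end Summit.ABC.Harvest

end
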